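import Literature.LinearAlgebra.QuadraticForm.OrientationCharacterDeterminant
import Literature.Topology.FourManifolds.LatticeFormsOrientationCharacter
import HarnessLib

/-!
# `O⁺(L)`, `O⁺(L(−1))` and the determinant: `det γ = χ₊(γ) · χ₋(γ)`, `SO⁺(L) = O⁺(L) ∩ O⁺(L(−1))`
# (Gritsenko–Hulek–Sankaran, Doc. Math. 12 (2007) §3; Shirokov §5.1)

Trunk T-4MAN vocabulary; sequel of `LatticeFormsOrientationCharacter` (`O⁺(L)`: `IsometryEquiv.IsOrientationPreserving γ`
= the realisation `γ ⊗ ℝ = realEnd γ` preserves the orientation of the positive directions of `L ⊗ ℝ = (ℝ^ι, realForm Q)`)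
and of `LinearAlgebra/QuadraticForm/OrientationCharacterDeterminant` (for a real isometry `g`:
`0 < det g ⟺ (g ∈ O⁺(S) ⟺ g ∈ O⁺(−S))`, `det R_v = −1`). Written for lane `lit-hodgefound` (Track 2 foundations;
prover seat `lit-hodgefound-p18`, gen 48, row g48-#2). THEOREMS ONLY — no definition, no named fact, no instance,
no notation.

## Sources, verbatim

* V. Gritsenko, K. Hulek, G. K. Sankaran, *The Hirzebruch–Mumford volume for the orthogonal group and
  applications*, Doc. Math. 12 (2007) [`GritsenkoHulekSankaran2007HM`; held `paper:arxiv-math_0512595` p. 9]: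
  "The `(−1)`-spinor norm on the group `O(L ⊗ ℝ)` can be defined as follows. Every element `g` can be represented
  as a product of reflections `g = σ_{v_1}·…·σ_{v_m}` and, following Brieskorn [Br], we define `sn_{−1}(g) = +1` if
  `(v_k, v_k) > 0` for an even number of `v_k`, `−1` otherwise. […] It is well known that
  `O⁺(L) = Ker(sn_{−1}) ∩ O(L)`. To see this, note that any reflection with respect to a vector of negative square
  has `(−1)`-spinor norm equal to `1`, and any reflection with respect to a vector of positive square has
  `(−1)`-spinor norm equal to `(−1)` and interchanges the two components. […] Finally the groups `SO⁺(L)` and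
  `S̃O⁺(L)` are defined as the corresponding groups of isometries of determinant `1`." (Lemma 4.2: the `2:1`
  inclusions `SO⁺(L) ⊂ O⁺(L) ⊂ O(L)`.)
* D. S. Shirokov, Geom. Integrability & Quantization 19 (2018) §5.1 [`Shirokov2018CliffordLectures`, held
  `paper:arxiv-1709.06608` p. 15]: "`A ∈ O(p,q) ⟹ det A = ±1`, […] `A^{1…p}_{1…p} = A^{p+1…n}_{p+1…n} / det A`
  […] `SO₊(p,q) = {A ∈ O(p,q) : A^{1…p}_{1…p} ≥ 1, A^{p+1…n}_{p+1…n} ≥ 1}`".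
* D. Huybrechts, *Lectures on K3 Surfaces*, Ch. 7 §5.4 (`O⁺(Λ)`: "the spinor norm is `+1` if `(δ)² < 0` and `−1`
  otherwise"; orientation of the positive directions).

## Rendering

The lattice `L(−1) = (L, −Q)` has the realisation of record `realForm (−Q) = −realForm Q` (§1), so
"`γ ∈ O⁺(L(−1))`" for an isometry `γ ∈ O(L) = O(L(−1))` is
`QuadraticForm.IsOrientationPreserving (realForm (−Q)) (realEnd γ)` — the orientation character `χ₋` of the
NEGATIVE directions of `L ⊗ ℝ` (and literally `γ'.IsOrientationPreserving` for any `γ' : (−Q).IsometryEquiv (−Q)`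
with the same underlying map, `IsometryEquiv.isOrientationPreserving_iff_of_negForm`). In these terms GHS's
`sn_{−1}`-kernel is `O⁺(L)` (`χ₊`; reflections in negative vectors lie in it — companion §6), the classical spinor
norm kernel is `O⁺(L(−1))` (`χ₋`; reflections in POSITIVE vectors lie in it, §3), and `det = χ₊ χ₋` (§2).

## Contents (all proved)

* §1 `realForm_neg`, `det_realEnd` (`det (f ⊗ ℝ) = det f`), `realForm_coord` (the real form on coordinate vectors
  of lattice vectors is `Q`), `sigNeg_realForm`.
* §2 for `γ ∈ O(L)` (`Q` symmetric non-degenerate): `det γ = ±1` (`IsometryEquiv.det_eq_one_or_eq_neg_one`, any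
  `Q`); **`γ ⊗ ℝ ∈ O⁺(L(−1)) ⟺ (γ ∈ O⁺(L) ⟺ det γ = 1)`** (`IsometryEquiv.isOrientationPreserving_realForm_neg_iff`,
  `…_iff_of_negForm`); **`0 < det γ ⟺ (γ ∈ O⁺(L) ⟺ γ ∈ O⁺(L(−1)))`** (`IsometryEquiv.det_pos_iff`,
  `det_eq_one_iff`); GHS's **`SO⁺(L) = O⁺(L) ∩ SO(L) = O⁺(L) ∩ O⁺(L(−1)) = O⁺(L(−1)) ∩ SO(L)`**
  (`IsometryEquiv.isOrientationPreserving_and_det_eq_one_iff`, `…_realForm_neg_and_det_eq_one_iff`); `χ₋` is a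
  character on `O(L)` (`IsometryEquiv.isOrientationPreserving_realForm_neg_trans_iff`, `…_refl`, `…_symm_iff`).
* §3 readings: `det(−id) = (−1)^{rk L}` and `−id ∈ O⁺(L(−1)) ⟺ n₋(L)` even; a lattice reflection
  (`(r,r) γ(x) = (r,r) x − 2(x,r) r`) has `det = −1` and lies in `O⁺(L(−1))` iff `(r,r) > 0` ("any reflection with
  respect to a vector of positive square has `(−1)`-spinor norm `−1`", while its classical spinor norm is `+1`);
  `σ_r` for `r² = ±2`; Markman's `ρ_u = −σ_u` (`u² = 2`) has `det ρ_u = (−1)^{rk L + 1}`.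

NOT here: the spinor norm as a product over a reflection factorisation (Cartan–Dieudonné), `S̃O⁺(L)` and the
indices of GHS Lemma 4.2 beyond `[O⁺ : SO⁺] ≤ 2`.
-/

noncomputable section

open Module Matrix
open LinearMap (BilinForm)
open Literature.LinearAlgebra.QuadraticForm Literature.Topology.FourManifolds

namespace LinearMap.BilinForm

universe u

/-! ### §1 The realisation of `L(−1)`; `det (f ⊗ ℝ) = det f` -/

section RealForm

variable {L : Type u} [AddCommGroup L] [Module.Finite ℤ L] [Module.Free ℤ L] (Q : BilinForm ℤ L)

/-- **`L(−1) ⊗ ℝ = −(L ⊗ ℝ)` in the coordinates of record**: `realForm (−Q) = −realForm Q`.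
[cite: GritsenkoHulekSankaran2007HM, §3 (the `(−1)`-spinor norm)] -/
theorem realForm_neg : realForm (-Q) = -realForm Q := by
  rw [realForm, realForm, map_neg, Matrix.map_neg _ (map_neg _), map_neg]

/-- **`det (f ⊗ ℝ) = det f`**: the realisation of record of a lattice endomorphism has the (real cast of the)
integer determinant of `f`. [cite: GritsenkoHulekSankaran2007HM, §3 ("isometries of determinant 1")] -/
theorem det_realEnd (f : L →ₗ[ℤ] L) : (realEnd f).det = ((LinearMap.det f : ℤ) : ℝ) := by
  rw [ContinuousLinearMap.det, realEnd, LinearMap.coe_toContinuousLinearMap, realMap, LinearMap.det_toLin,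
    ← RingHom.mapMatrix_apply, ← RingHom.map_det, LinearMap.det_toMatrix, eq_intCast]

omit [Module.Finite ℤ L] [Module.Free ℤ L] in
/-- The lattice form in coordinates, cast to `ℝ`: `(Q x y : ℝ) = Σ_k Σ_l x_k y_l Q(b_k, b_l)`. [folklore] -/
private theorem intCast_apply_eq_sum' {κ : Type*} [Fintype κ] (b : Basis κ ℤ L) (x y : L) :
    ((Q x y : ℤ) : ℝ) = ∑ k, ∑ l, ((b.repr x k : ℤ) : ℝ) * ((b.repr y l : ℤ) : ℝ) * ((Q (b k) (b l) : ℤ) : ℝ) := by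
  rw [← LinearMap.BilinForm.sum_repr_mul_repr_mul b x y, Finsupp.sum_fintype _ _ (fun _ ↦ by simp),
    Int.cast_sum]
  refine Finset.sum_congr rfl fun k _ ↦ ?_
  rw [Finsupp.sum_fintype _ _ (fun _ ↦ by simp)]
  push_cast
  refine Finset.sum_congr rfl fun l _ ↦ ?_
  simp only [smul_eq_mul, Int.cast_mul, mul_assoc]

/-- **The realisation of record evaluates lattice vectors as `Q` does**: on the coordinate vectors
`x ⊗ 1 = (xᵢ)ᵢ`, `r ⊗ 1 = (rᵢ)ᵢ` of `x, r ∈ L` (coordinates in `Module.Free.chooseBasis ℤ L`),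
`realForm Q (x ⊗ 1) (r ⊗ 1) = Q(x, r)`. [cite: Huybrechts2016K3, Ch. 7 §5.4 ("the underlying real vector space")] [cite: Serre1973, Ch. V §1.3.2] -/
theorem realForm_coord (x r : L) :
    realForm Q (fun i ↦ ((Module.Free.chooseBasis ℤ L).repr x i : ℝ))
        (fun i ↦ ((Module.Free.chooseBasis ℤ L).repr r i : ℝ)) = (Q x r : ℝ) := by
  rw [realForm, Matrix.toBilin'_apply, intCast_apply_eq_sum' Q (Module.Free.chooseBasis ℤ L) x r]
  refine Finset.sum_congr rfl fun k _ ↦ Finset.sum_congr rfl fun l _ ↦ ?_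
  rw [Matrix.map_apply, BilinForm.toMatrix_apply, eq_intCast]
  ring

/-- **The negative index of `L ⊗ ℝ` is the lattice index `n₋(L) = sigNeg Q`** (companion: `sigPos_realForm`).
[cite: Serre1973, Ch. V §1.3.2] [cite: MilnorHusemoller1973, Ch. II §2] -/
theorem sigNeg_realForm (hQ : Q.IsSymm) (hnd : Q.Nondegenerate) :
    sigNeg (realForm Q).toQuadraticMap = sigNeg Q.toQuadraticMap :=
  (sigNeg_eq_sigNeg_of_gram_eq Q (realForm Q) (Module.Free.chooseBasis ℤ L)
    (Pi.basisFun ℝ (Module.Free.ChooseBasisIndex ℤ L)) hQ (fun x hx ↦ hnd.1 x hx) (realForm_basisFun Q)).symm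

end RealForm

/-! ### §2 `det γ = χ₊(γ) χ₋(γ)` on `O(L)`; `SO⁺(L) = O⁺(L) ∩ O⁺(L(−1))` -/

section Det

variable {L : Type u} [AddCommGroup L] [Module.Finite ℤ L] [Module.Free ℤ L] {Q : BilinForm ℤ L}

omit [Module.Finite ℤ L] [Module.Free ℤ L] in
/-- `(g.trans h) = h ∘ g` as linear maps. [folklore] -/
private theorem IsometryEquiv.coe_trans_eq_comp (g h : Q.IsometryEquiv Q) :
    ((g.trans h : Q.IsometryEquiv Q) : L →ₗ[ℤ] L) = (h : L →ₗ[ℤ] L) ∘ₗ (g : L →ₗ[ℤ] L) :=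
  LinearMap.ext fun _ ↦ rfl

omit [Module.Finite ℤ L] [Module.Free ℤ L] in
/-- **`det γ = ±1` for `γ ∈ O(L)`** (indeed for every `ℤ`-linear automorphism: `det γ · det γ⁻¹ = 1` in `ℤ`).
[cite: Shirokov2018CliffordLectures, §5.1 ("det A = ±1")] [cite: GritsenkoHulekSankaran2007HM, §3] -/
theorem IsometryEquiv.det_eq_one_or_eq_neg_one (g : Q.IsometryEquiv Q) :
    LinearMap.det (g : L →ₗ[ℤ] L) = 1 ∨ LinearMap.det (g : L →ₗ[ℤ] L) = -1 := by
  refine Int.isUnit_iff.1 (IsUnit.of_mul_eq_one (LinearMap.det ((g.symm : Q.IsometryEquiv Q) : L →ₗ[ℤ] L)) ?_)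
  rw [← LinearMap.det_comp]
  have h : (g : L →ₗ[ℤ] L) ∘ₗ ((g.symm : Q.IsometryEquiv Q) : L →ₗ[ℤ] L) = LinearMap.id := by
    ext x
    exact g.toLinearEquiv.apply_symm_apply x
  rw [h, LinearMap.det_id]

omit [Module.Finite ℤ L] [Module.Free ℤ L] in
/-- `det (γ.trans δ) = det δ · det γ`. [folklore] -/
private theorem IsometryEquiv.det_trans (g h : Q.IsometryEquiv Q) :
    LinearMap.det ((g.trans h : Q.IsometryEquiv Q) : L →ₗ[ℤ] L) =
      LinearMap.det (h : L →ₗ[ℤ] L) * LinearMap.det (g : L →ₗ[ℤ] L) := by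
  rw [IsometryEquiv.coe_trans_eq_comp, LinearMap.det_comp]

/-- `det (γ ⊗ ℝ) = det γ` for an isometry. [cite: GritsenkoHulekSankaran2007HM, §3] -/
theorem IsometryEquiv.det_realEnd (g : Q.IsometryEquiv Q) :
    (realEnd (g : L →ₗ[ℤ] L)).det = ((LinearMap.det (g : L →ₗ[ℤ] L) : ℤ) : ℝ) :=
  LinearMap.BilinForm.det_realEnd (g : L →ₗ[ℤ] L)

variable (Q)

/-- **`γ ⊗ ℝ ∈ O⁺(L(−1)) ⟺ (γ ∈ O⁺(L) ⟺ det γ = 1)`** for `γ ∈ O(L)`, `Q` symmetric non-degenerate: the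
orientation character of the NEGATIVE directions (the classical spinor-norm kernel, GHS's `O⁺` being the
`sn_{−1}`-kernel) is the character of the positive directions times `det` — `det γ = χ₊(γ) χ₋(γ)`.
[cite: GritsenkoHulekSankaran2007HM, §3 ("O⁺(L) = Ker(sn_{−1}) ∩ O(L)", "SO⁺(L) … isometries of determinant 1")] [cite: Shirokov2018CliffordLectures, §5.1] -/
theorem IsometryEquiv.isOrientationPreserving_realForm_neg_iff (hQ : Q.IsSymm) (hnd : Q.Nondegenerate)
    (g : Q.IsometryEquiv Q) :
    Literature.LinearAlgebra.QuadraticForm.IsOrientationPreserving (realForm (-Q)) (realEnd (g : L →ₗ[ℤ] L)) ↔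
      (g.IsOrientationPreserving ↔ LinearMap.det (g : L →ₗ[ℤ] L) = 1) := by
  rw [realForm_neg, IsometryEquiv.isOrientationPreserving_iff,
    Literature.LinearAlgebra.QuadraticForm.isOrientationPreserving_neg_iff_iff_det (isSymm_realForm Q hQ)
      (nondegenerate_realForm Q hnd) (apply_realEnd_realEnd fun x y ↦ g.map_app y x),
    IsometryEquiv.det_realEnd, Int.cast_eq_one]

/-- **The same, for an isometry `γ'` of `L(−1) = (L, −Q)` with the same underlying map as `γ ∈ O(L)`**:
`γ' ∈ O⁺(L(−1)) ⟺ (γ ∈ O⁺(L) ⟺ det γ = 1)`. [cite: GritsenkoHulekSankaran2007HM, §3] -/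
theorem IsometryEquiv.isOrientationPreserving_iff_of_negForm (hQ : Q.IsSymm) (hnd : Q.Nondegenerate)
    (g : Q.IsometryEquiv Q) (g' : (-Q).IsometryEquiv (-Q)) (h : (g' : L →ₗ[ℤ] L) = (g : L →ₗ[ℤ] L)) :
    g'.IsOrientationPreserving ↔ (g.IsOrientationPreserving ↔ LinearMap.det (g : L →ₗ[ℤ] L) = 1) := by
  rw [IsometryEquiv.isOrientationPreserving_iff, h]
  exact IsometryEquiv.isOrientationPreserving_realForm_neg_iff Q hQ hnd g

/-- **`det γ = χ₊(γ) χ₋(γ)`**: `0 < det γ ⟺ (γ ∈ O⁺(L) ⟺ γ ⊗ ℝ ∈ O⁺(L(−1)))`.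
[cite: Shirokov2018CliffordLectures, §5.1] [cite: GritsenkoHulekSankaran2007HM, §3] -/
theorem IsometryEquiv.det_pos_iff (hQ : Q.IsSymm) (hnd : Q.Nondegenerate) (g : Q.IsometryEquiv Q) :
    0 < LinearMap.det (g : L →ₗ[ℤ] L) ↔
      (g.IsOrientationPreserving ↔
        Literature.LinearAlgebra.QuadraticForm.IsOrientationPreserving (realForm (-Q)) (realEnd (g : L →ₗ[ℤ] L))) := by
  rw [IsometryEquiv.isOrientationPreserving_realForm_neg_iff Q hQ hnd g]
  rcases g.det_eq_one_or_eq_neg_one with h | h <;> rw [h] <;> norm_num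

/-- `det γ = 1 ⟺ (γ ∈ O⁺(L) ⟺ γ ⊗ ℝ ∈ O⁺(L(−1)))`. [cite: Shirokov2018CliffordLectures, §5.1] [cite: GritsenkoHulekSankaran2007HM, §3] -/
theorem IsometryEquiv.det_eq_one_iff (hQ : Q.IsSymm) (hnd : Q.Nondegenerate) (g : Q.IsometryEquiv Q) :
    LinearMap.det (g : L →ₗ[ℤ] L) = 1 ↔
      (g.IsOrientationPreserving ↔
        Literature.LinearAlgebra.QuadraticForm.IsOrientationPreserving (realForm (-Q)) (realEnd (g : L →ₗ[ℤ] L))) := by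
  rw [IsometryEquiv.isOrientationPreserving_realForm_neg_iff Q hQ hnd g]
  rcases g.det_eq_one_or_eq_neg_one with h | h <;> rw [h] <;> norm_num

/-- **GHS's `SO⁺(L) = O⁺(L) ∩ SO(L)` is `O⁺(L) ∩ O⁺(L(−1))`**: `γ ∈ O⁺(L) ∧ det γ = 1 ⟺ γ ∈ O⁺(L) ∧ γ ⊗ ℝ ∈ O⁺(L(−1))`
("`SO₊(p,q) = {A ∈ O(p,q) : A^{1…p}_{1…p} ≥ 1, A^{p+1…n}_{p+1…n} ≥ 1}`").
[cite: GritsenkoHulekSankaran2007HM, §3 ("the groups SO⁺(L) … are defined as the corresponding groups of isometries of determinant 1")] [cite: Shirokov2018CliffordLectures, §5.1] -/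
theorem IsometryEquiv.isOrientationPreserving_and_det_eq_one_iff (hQ : Q.IsSymm) (hnd : Q.Nondegenerate)
    (g : Q.IsometryEquiv Q) :
    g.IsOrientationPreserving ∧ LinearMap.det (g : L →ₗ[ℤ] L) = 1 ↔
      g.IsOrientationPreserving ∧
        Literature.LinearAlgebra.QuadraticForm.IsOrientationPreserving (realForm (-Q)) (realEnd (g : L →ₗ[ℤ] L)) := by
  rw [IsometryEquiv.isOrientationPreserving_realForm_neg_iff Q hQ hnd g]
  tauto

/-- **`SO⁺(L) = O⁺(L(−1)) ∩ SO(L)`**: `γ ⊗ ℝ ∈ O⁺(L(−1)) ∧ det γ = 1 ⟺ γ ∈ O⁺(L) ∧ γ ⊗ ℝ ∈ O⁺(L(−1))`.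
[cite: GritsenkoHulekSankaran2007HM, §3] [cite: Shirokov2018CliffordLectures, §5.1 ("= {A ∈ SO(p,q) : A^{p+1…n}_{p+1…n} ≥ 1}")] -/
theorem IsometryEquiv.isOrientationPreserving_realForm_neg_and_det_eq_one_iff (hQ : Q.IsSymm)
    (hnd : Q.Nondegenerate) (g : Q.IsometryEquiv Q) :
    Literature.LinearAlgebra.QuadraticForm.IsOrientationPreserving (realForm (-Q)) (realEnd (g : L →ₗ[ℤ] L)) ∧
        LinearMap.det (g : L →ₗ[ℤ] L) = 1 ↔
      g.IsOrientationPreserving ∧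
        Literature.LinearAlgebra.QuadraticForm.IsOrientationPreserving (realForm (-Q)) (realEnd (g : L →ₗ[ℤ] L)) := by
  rw [IsometryEquiv.isOrientationPreserving_realForm_neg_iff Q hQ hnd g]
  rcases g.det_eq_one_or_eq_neg_one with h | h <;> rw [h] <;> norm_num

/-- **`γ ∈ O⁺(L) ∩ O⁺(L(−1)) ⟹ det γ = 1`** (`SO⁺ ⊂ SO`). [cite: GritsenkoHulekSankaran2007HM, §3] -/
theorem IsometryEquiv.det_eq_one_of_isOrientationPreserving (hQ : Q.IsSymm) (hnd : Q.Nondegenerate)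
    (g : Q.IsometryEquiv Q) (hpos : g.IsOrientationPreserving)
    (hneg : Literature.LinearAlgebra.QuadraticForm.IsOrientationPreserving (realForm (-Q)) (realEnd (g : L →ₗ[ℤ] L))) :
    LinearMap.det (g : L →ₗ[ℤ] L) = 1 :=
  (IsometryEquiv.det_eq_one_iff Q hQ hnd g).2 (iff_of_true hpos hneg)

/-- `id ⊗ ℝ ∈ O⁺(L(−1))`. [cite: GritsenkoHulekSankaran2007HM, §3] -/
theorem IsometryEquiv.isOrientationPreserving_realForm_neg_refl :
    Literature.LinearAlgebra.QuadraticForm.IsOrientationPreserving (realForm (-Q))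
      (realEnd ((IsometryEquiv.refl Q : Q.IsometryEquiv Q) : L →ₗ[ℤ] L)) := by
  rw [IsometryEquiv.realEnd_refl]
  exact IsOrientationPreserving.one

/-- An isometry of `L` realises as an operator carrying `(−realForm Q)`-positive vectors to
`(−realForm Q)`-positive vectors. [folklore] -/
private theorem IsometryEquiv.pos_apply_realEnd_neg (g : Q.IsometryEquiv Q) :
    ∀ v, 0 < (-realForm Q) v v → 0 < (-realForm Q) (realEnd (g : L →ₗ[ℤ] L) v) (realEnd (g : L →ₗ[ℤ] L) v) :=
  fun v hv ↦ by
    simp only [LinearMap.neg_apply] at hv ⊢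
    rwa [apply_realEnd_realEnd fun x y ↦ g.map_app y x]

/-- **`χ₋` is a character on `O(L)`**: `(γδ) ⊗ ℝ ∈ O⁺(L(−1)) ⟺ (δ ⊗ ℝ ∈ O⁺(L(−1)) ⟺ γ ⊗ ℝ ∈ O⁺(L(−1)))`
(`γ.trans δ = δ ∘ γ`; the real character property for `−realForm Q` at the complementary projection `1 − P`).
[cite: GritsenkoHulekSankaran2007HM, §3 (sn is a homomorphism)] [cite: Huybrechts2016K3, Ch. 7 §5.4 ("extended multiplicatively")] -/
theorem IsometryEquiv.isOrientationPreserving_realForm_neg_trans_iff (hQ : Q.IsSymm) (hnd : Q.Nondegenerate)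
    (g h : Q.IsometryEquiv Q) :
    Literature.LinearAlgebra.QuadraticForm.IsOrientationPreserving (realForm (-Q))
        (realEnd ((g.trans h : Q.IsometryEquiv Q) : L →ₗ[ℤ] L)) ↔
      (Literature.LinearAlgebra.QuadraticForm.IsOrientationPreserving (realForm (-Q)) (realEnd (h : L →ₗ[ℤ] L)) ↔
        Literature.LinearAlgebra.QuadraticForm.IsOrientationPreserving (realForm (-Q)) (realEnd (g : L →ₗ[ℤ] L))) := by
  obtain ⟨P, hP⟩ := exists_isPosProjection_realForm Q hQ hnd
  rw [realForm_neg, IsometryEquiv.realEnd_trans]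
  exact hP.one_sub.isOrientationPreserving_mul_iff (isSymm_realForm Q hQ).neg h.pos_apply_realEnd_neg
    g.pos_apply_realEnd_neg

/-- `γ⁻¹ ⊗ ℝ ∈ O⁺(L(−1)) ⟺ γ ⊗ ℝ ∈ O⁺(L(−1))`. [cite: GritsenkoHulekSankaran2007HM, §3] -/
theorem IsometryEquiv.isOrientationPreserving_realForm_neg_symm_iff (hQ : Q.IsSymm) (hnd : Q.Nondegenerate)
    (g : Q.IsometryEquiv Q) :
    Literature.LinearAlgebra.QuadraticForm.IsOrientationPreserving (realForm (-Q))
        (realEnd ((g.symm : Q.IsometryEquiv Q) : L →ₗ[ℤ] L)) ↔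
      Literature.LinearAlgebra.QuadraticForm.IsOrientationPreserving (realForm (-Q)) (realEnd (g : L →ₗ[ℤ] L)) := by
  have h := IsometryEquiv.isOrientationPreserving_realForm_neg_trans_iff Q hQ hnd g g.symm
  have h1 : ((g.trans g.symm : Q.IsometryEquiv Q) : L →ₗ[ℤ] L) = LinearMap.id := by
    ext x
    exact g.toLinearEquiv.symm_apply_apply x
  rw [h1, realEnd_id] at h
  exact h.1 IsOrientationPreserving.one

end Det

/-! ### §3 Readings: `−id`, reflections, `σ_r` (`r² = ±2`), Markman's `ρ_u` -/

section Readings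

variable {L : Type u} [AddCommGroup L] [Module.Finite ℤ L] [Module.Free ℤ L] (Q : BilinForm ℤ L)

/-- **`det(−id_L) = (−1)^{rk L}`.** [cite: Huybrechts2016K3, Ch. 7 §5.4 Thm. 5.7 ("id ⊕ (−id_U)")] -/
theorem IsometryEquiv.det_neg :
    LinearMap.det ((IsometryEquiv.neg Q : Q.IsometryEquiv Q) : L →ₗ[ℤ] L) = (-1) ^ finrank ℤ L := by
  have h : ((IsometryEquiv.neg Q : Q.IsometryEquiv Q) : L →ₗ[ℤ] L) = -LinearMap.id := by
    ext x
    rfl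
  rw [h, ← LinearMap.det_toMatrix (Module.Free.chooseBasis ℤ L), map_neg, LinearMap.toMatrix_id, Matrix.det_neg,
    Matrix.det_one, mul_one, Module.finrank_eq_card_chooseBasisIndex]

/-- **`−id ⊗ ℝ ∈ O⁺(L(−1)) ⟺ n₋(L) = sigNeg Q` is even** (companion: `−id ∈ O⁺(L) ⟺ n₊(L)` even; for the K3
lattice `n₋ = 19`: `−id ∉ O⁺(Λ(−1))` either, consistently with `det(−id) = +1`).
[cite: Huybrechts2016K3, Ch. 7 §5.4 Prop. 5.5 and Thm. 5.7] [cite: GritsenkoHulekSankaran2007HM, §3] -/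
theorem IsometryEquiv.isOrientationPreserving_realForm_neg_neg_iff (hQ : Q.IsSymm) (hnd : Q.Nondegenerate) :
    Literature.LinearAlgebra.QuadraticForm.IsOrientationPreserving (realForm (-Q))
        (realEnd ((IsometryEquiv.neg Q : Q.IsometryEquiv Q) : L →ₗ[ℤ] L)) ↔ Even (sigNeg Q.toQuadraticMap) := by
  rw [realForm_neg, IsometryEquiv.realEnd_neg,
    Literature.LinearAlgebra.QuadraticForm.isOrientationPreserving_neg_neg_one_iff_even_sigNeg (isSymm_realForm Q hQ)
      (nondegenerate_realForm Q hnd), sigNeg_realForm Q hQ hnd]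

/-- **Parity check `rk L = n₊ + n₋` through the characters of `−id`**: `n₋` even ⟺ (`n₊` even ⟺ `rk L` even).
[cite: Serre1973, Ch. V §1.3.2 ("r + s = n")] -/
theorem even_sigNeg_iff (hQ : Q.IsSymm) (hnd : Q.Nondegenerate) :
    Even (sigNeg Q.toQuadraticMap) ↔ (Even (sigPos Q.toQuadraticMap) ↔ Even (finrank ℤ L)) := by
  rw [← IsometryEquiv.isOrientationPreserving_realForm_neg_neg_iff Q hQ hnd,
    IsometryEquiv.isOrientationPreserving_realForm_neg_iff Q hQ hnd, IsometryEquiv.isOrientationPreserving_neg_iff Q hQ hnd,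
    IsometryEquiv.det_neg, neg_one_pow_eq_one_iff_even (by norm_num)]

variable {Q}

/-- **A lattice reflection has determinant `−1`**: if `γ : L → L` satisfies `(r,r) γ(x) = (r,r) x − 2 (x,r) r`
with `(r,r) ≠ 0`, then `det γ = −1` (read on `γ ⊗ ℝ`, the real reflection in `r ⊗ 1`).
[cite: Huybrechts2016K3, Ch. 7 §5.4 (s_δ)] [cite: GritsenkoHulekSankaran2007HM, §3 (σ_v)] -/
theorem det_eq_neg_one_of_reflection {g : L →ₗ[ℤ] L} {r : L} (hr : Q r r ≠ 0)
    (hg : ∀ x, Q r r • g x = Q r r • x - (2 * Q x r) • r) : LinearMap.det g = -1 := by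
  have hrr : realForm Q (fun i ↦ ((Module.Free.chooseBasis ℤ L).repr r i : ℝ))
      (fun i ↦ ((Module.Free.chooseBasis ℤ L).repr r i : ℝ)) ≠ 0 := by
    rw [realForm_coord Q r r]
    exact_mod_cast hr
  have h := Literature.LinearAlgebra.QuadraticForm.det_reflection hrr (realEnd_apply_of_reflection hr hg)
  rw [det_realEnd] at h
  exact_mod_cast h

/-- **A reflection isometry `γ ∈ O(L)` in `r` (`(r,r) ≠ 0`) has `det γ = −1`.** [cite: Huybrechts2016K3, Ch. 7 §5.4 (s_δ)] -/
theorem IsometryEquiv.det_of_reflection (g : Q.IsometryEquiv Q) {r : L} (hr : Q r r ≠ 0)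
    (hg : ∀ x, Q r r • g x = Q r r • x - (2 * Q x r) • r) : LinearMap.det (g : L →ₗ[ℤ] L) = -1 :=
  det_eq_neg_one_of_reflection hr fun x ↦ hg x

variable (Q)

/-- **A reflection `γ ∈ O(L)` in `r` lies in `O⁺(L(−1))` iff `(r, r) > 0`** — it preserves the orientation of
the negative directions iff `r` is a positive vector (its classical spinor norm is then `+1`, while "any reflection
with respect to a vector of positive square has `(−1)`-spinor norm equal to `(−1)`": companion
`isOrientationPreserving_iff_of_reflection`, `γ ∈ O⁺(L) ⟺ (r,r) < 0`).
[cite: GritsenkoHulekSankaran2007HM, §3] [cite: Huybrechts2016K3, Ch. 7 §5.4] -/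
theorem IsometryEquiv.isOrientationPreserving_realForm_neg_iff_of_reflection (hQ : Q.IsSymm)
    (hnd : Q.Nondegenerate) (g : Q.IsometryEquiv Q) {r : L} (hr : Q r r ≠ 0)
    (hg : ∀ x, Q r r • g x = Q r r • x - (2 * Q x r) • r) :
    Literature.LinearAlgebra.QuadraticForm.IsOrientationPreserving (realForm (-Q)) (realEnd (g : L →ₗ[ℤ] L)) ↔
      0 < Q r r := by
  have hrr : realForm Q (fun i ↦ ((Module.Free.chooseBasis ℤ L).repr r i : ℝ))
      (fun i ↦ ((Module.Free.chooseBasis ℤ L).repr r i : ℝ)) = (Q r r : ℝ) := realForm_coord Q r r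
  have hrr0 : realForm Q (fun i ↦ ((Module.Free.chooseBasis ℤ L).repr r i : ℝ))
      (fun i ↦ ((Module.Free.chooseBasis ℤ L).repr r i : ℝ)) ≠ 0 := by
    rw [hrr]
    exact_mod_cast hr
  rw [realForm_neg, Literature.LinearAlgebra.QuadraticForm.isOrientationPreserving_neg_reflection_iff_pos
    (isSymm_realForm Q hQ) (nondegenerate_realForm Q hnd) hrr0
    (realEnd_apply_of_reflection hr fun x ↦ hg x), hrr, Int.cast_pos]

/-- **`det σ_r = −1`** for the reflection in a `(±2)`-vector `r` (`r² = 2ε`, `ε = ±1`).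
[cite: Huybrechts2016K3, Ch. 7 §5.4 (s_δ)] [cite: MilnorHusemoller1973, §I.3] -/
theorem det_normTwoReflectionEquiv (hQ : Q.IsSymm) (r : L) (ε : ℤ) (hr : Q r r = ε + ε) (hε : ε * ε = 1) :
    LinearMap.det ((normTwoReflectionEquiv hQ r ε hr hε : Q.IsometryEquiv Q) : L →ₗ[ℤ] L) = -1 := by
  have hε' : ε = 1 ∨ ε = -1 := mul_self_eq_one_iff.1 hε
  have hr0 : Q r r ≠ 0 := by rcases hε' with h | h <;> simp [hr, h]
  exact IsometryEquiv.det_of_reflection _ hr0 (normTwoReflectionEquiv_integral Q hQ r ε hr hε)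

/-- **`σ_r ⊗ ℝ ∈ O⁺(L(−1)) ⟺ r² = +2`** (`r² = 2ε`): reflections in `(+2)`-vectors preserve, reflections in
`(−2)`-vectors reverse, the orientation of the NEGATIVE directions (companion: `σ_r ∈ O⁺(L) ⟺ ε = −1`).
[cite: GritsenkoHulekSankaran2007HM, §3 ("sn_{−1}(σ_v) = −1 and sn_{−1}(σ_u) = 1")] [cite: Huybrechts2016K3, Ch. 7 §5.4] -/
theorem isOrientationPreserving_realForm_neg_normTwoReflectionEquiv_iff (hQ : Q.IsSymm) (hnd : Q.Nondegenerate)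
    (r : L) (ε : ℤ) (hr : Q r r = ε + ε) (hε : ε * ε = 1) :
    Literature.LinearAlgebra.QuadraticForm.IsOrientationPreserving (realForm (-Q))
        (realEnd ((normTwoReflectionEquiv hQ r ε hr hε : Q.IsometryEquiv Q) : L →ₗ[ℤ] L)) ↔ ε = 1 := by
  have hε' : ε = 1 ∨ ε = -1 := mul_self_eq_one_iff.1 hε
  have hr0 : Q r r ≠ 0 := by rcases hε' with h | h <;> simp [hr, h]
  rw [IsometryEquiv.isOrientationPreserving_realForm_neg_iff_of_reflection Q hQ hnd _ hr0
    (normTwoReflectionEquiv_integral Q hQ r ε hr hε), hr]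
  rcases hε' with h | h <;> subst h <;> norm_num

/-- **Markman's `ρ_u = −σ_u` (`u² = 2`) has `det ρ_u = (−1)^{rk L + 1}`** (for `Λ(K3^{[n]})` of rank `23`:
`det ρ_u = +1`, so `ρ_u ∈ SO⁺`; for the K3 lattice of rank `22`: `det ρ_u = −1`).
[cite: Markman2011Survey, §9.1.1 ("Set ρ_u := −R_u if (u,u) > 0")] -/
theorem det_neg_trans_normTwoReflectionEquiv (hQ : Q.IsSymm) (u : L) (hu : Q u u = 1 + 1) :
    LinearMap.det (((IsometryEquiv.neg Q).trans (normTwoReflectionEquiv hQ u 1 hu (one_mul 1)) : Q.IsometryEquiv Q) :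
      L →ₗ[ℤ] L) = (-1) ^ (finrank ℤ L + 1) := by
  rw [IsometryEquiv.det_trans, det_normTwoReflectionEquiv Q hQ u 1 hu (one_mul 1), IsometryEquiv.det_neg, pow_succ,
    mul_comm]

/-- **`ρ_u ⊗ ℝ ∈ O⁺(L(−1)) ⟺ n₋(L)` is even** (`ρ_u = −σ_u`, `u² = 2`: `σ_u` preserves and `−id` acts by
`(−1)^{n₋}` on the orientation of the negative directions; companion: `ρ_u ∈ O⁺(L) ⟺ n₊(L)` odd).
[cite: Markman2011Survey, §9.1.1 (ρ_u)] [cite: GritsenkoHulekSankaran2007HM, §3] -/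
theorem isOrientationPreserving_realForm_neg_neg_trans_normTwoReflectionEquiv_iff (hQ : Q.IsSymm)
    (hnd : Q.Nondegenerate) (u : L) (hu : Q u u = 1 + 1) :
    Literature.LinearAlgebra.QuadraticForm.IsOrientationPreserving (realForm (-Q))
        (realEnd (((IsometryEquiv.neg Q).trans (normTwoReflectionEquiv hQ u 1 hu (one_mul 1)) : Q.IsometryEquiv Q) :
          L →ₗ[ℤ] L)) ↔ Even (sigNeg Q.toQuadraticMap) := by
  rw [IsometryEquiv.isOrientationPreserving_realForm_neg_trans_iff Q hQ hnd,
    isOrientationPreserving_realForm_neg_normTwoReflectionEquiv_iff Q hQ hnd,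
    IsometryEquiv.isOrientationPreserving_realForm_neg_neg_iff Q hQ hnd]
  norm_num

end Readings

end LinearMap.BilinForm
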